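import Summits.ResolutionOfSingularities.ResolutionOfSingularities.Theorems.WeightedInvariantHypersurfaceCentreAssemblyRegularOfPresentation
import Summits.ResolutionOfSingularities.ResolutionOfSingularities.Theorems.WeightedInvariantHypersurfaceCentreAssemblyGlue
import Summits.ResolutionOfSingularities.ResolutionOfSingularities.Theorems.WeightedInvariantHypersurfaceCentreAssemblyMaxLocus
import Summits.ResolutionOfSingularities.ResolutionOfSingularities.Theorems.WeightedInvariantHypersurfaceLocalGameEFT4S
import HarnessLib

/-!
# Door assembly H2c″, stub [S3] BY NAME — existence of the canonical centre from the ∀-model open presentation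

Route `ResolutionOfSingularities/WeightedInvariant`, crux `Theses.WeightedInvariant.HypersurfaceCentreConstruction`
(stmt-ResolutionOfSingularities-19897), door line `local-engine`, skeleton v3.1 (6182e6a42f97ef87), stub [S3]
`stub_exists_isCanonicalCentre` (holder of record res-L1-w43-stub-9 = res-D-brk-1; taken BY NAME by res-type-089 on the
holder's «YES, TAKE [S3]», STATUS 2026-08-27 l.34599).

* `exists_isCanonicalCentre_of_forallPresentation` — CONTENT of [S3] modulo the closedness of the maximum locus ([S1]):
  hypotheses (c6) `hc6`, (c12a) `hu`/`hJu`, `hJ`, and `hopen` = the body VERBATIM of the (open″) clause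
  `JOpenPresentationForallSing p ι J`; `f : Y → Spec k` smooth and quasi-compact over a perfect field of characteristic `p`,
  `X` locally principal, `maxLocus ι X` closed ⟹ `∃ R, IsCanonicalCentre ι J X R`. Proof: at each point `y` of the maximum
  locus the model `(Γ(Y,U₀), 𝔮_y, F)` of a principal chart is instantiated EXACTLY as in the [S4] content theorem
  `isRegularWeightedCentre_of_isCanonicalCentre_of_forallPresentation` (p505837, stub-9: regular model stalk, `F/1 ≠ 0`,
  `F/1 ∈ 𝔪²` by the point dictionary p505376, the clause, the cut `D(h h')` by `exists_not_mem_forall_algebraMap_ne_zero`,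
  model stratum = maximum locus via `iotaAt_eq_iota_localization`), producing the per-point presentation data that the
  gluing half `exists_isCanonicalCentre_of_presentations` (`…CentreAssemblyGlue`, res-type-089, over `Lib/ReesAlgebraGlue`)
  consumes.
* `stub_exists_isCanonicalCentre` — the REGISTERED header verbatim (section variables `p`, `ι`, `J`), closed by the content
  theorem + [S1] `stub_maxLocus` (p504597, res-type-057); `hgame` and `IsSeparated` are idle.
OURS; no claim about Hironaka's problem; AI-written, weaker than expert review. [cite: Wlodarczyk2022, §2.2 and 2.1.10]
-/

noncomputable section

set_option linter.dupNamespace false -- mandated namespace of this single-conjunct summit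

open CategoryTheory AlgebraicGeometry TopologicalSpace IsLocalRing
open Literature.AlgebraicGeometry.Resolution
open Summit.ResolutionOfSingularities.ResolutionOfSingularities.Theorems

namespace Summit.ResolutionOfSingularities.ResolutionOfSingularities.Cruxes.HypersurfaceCentreConstruction.LocalEngine

variable (ι : (R : Type) → [CommRing R] → R → Ordinal.{0}) (J : (R : Type) → [CommRing R] → R → ℕ → Ideal R)

/-- **[S3] modulo [S1]: a canonical centre of the hypersurface pair EXISTS**, given (c6), (c12a) for `ι` and `J`,
iso-invariance of `J`, the ∀-MODEL STRATUM-EXACT OPEN PRESENTATION clause (open″) (`hopen`, the body of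
`JOpenPresentationForallSing p ι J` verbatim), `f : Y → Spec k` smooth quasi-compact over a perfect field of characteristic
`p`, `X` locally principal and the maximum locus closed. [cite: Wlodarczyk2022, §2.2 and 2.1.10] -/
theorem exists_isCanonicalCentre_of_forallPresentation {p : ℕ}
    (hc6 : IotaIsoInvariant ι) (hu : IotaUnitInvariant ι) (hJ : JIsoInvariant J) (hJu : JUnitInvariant J)
    (hopen : ∀ (k₀ : Type) [Field k₀] [CharP k₀ p] [PerfectField k₀]
      (A : Type) [CommRing A] [Algebra k₀ A] [Algebra.FiniteType k₀ A] (𝔪 : Ideal A) [𝔪.IsPrime] (F : A),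
      IsRegularLocalRing (Localization.AtPrime 𝔪) →
      algebraMap A (Localization.AtPrime 𝔪) F ≠ 0 →
      algebraMap A (Localization.AtPrime 𝔪) F ∈ (maximalIdeal (Localization.AtPrime 𝔪)) ^ 2 →
      ∃ h : A, h ∉ 𝔪 ∧ ∃ (N : ℕ) (U : Fin N → A) (W : Fin N → ℕ), (∀ i, 0 < W i) ∧
        (∃ hU : ∀ i, algebraMap A (Localization.AtPrime 𝔪) (U i) ∈ maximalIdeal (Localization.AtPrime 𝔪),
          LinearIndependent (ResidueField (Localization.AtPrime 𝔪))
            (fun i => ((maximalIdeal (Localization.AtPrime 𝔪)).toCotangent ⟨_, hU i⟩ :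
              CotangentSpace (Localization.AtPrime 𝔪)))) ∧
        ∀ (𝔮 : Ideal A) [𝔮.IsPrime], h ∉ 𝔮 →
          ((∀ i, U i ∈ 𝔮) ↔
            (algebraMap A (Localization.AtPrime 𝔮) F ∈ (maximalIdeal (Localization.AtPrime 𝔮)) ^ 2 ∧
              ι (Localization.AtPrime 𝔮) (algebraMap A (Localization.AtPrime 𝔮) F) =
                ι (Localization.AtPrime 𝔪) (algebraMap A (Localization.AtPrime 𝔪) F))) ∧
          ((∀ i, U i ∈ 𝔮) → ∀ m : ℕ,
            J (Localization.AtPrime 𝔮) (algebraMap A (Localization.AtPrime 𝔮) F) m =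
              (weightedMonomialIdeal U W m).map (algebraMap A (Localization.AtPrime 𝔮))))
    {k : Type} [Field k] [CharP k p] [PerfectField k] {Y : Scheme.{0}} (f : Y ⟶ Spec (.of k)) [Smooth f]
    [QuasiCompact f] (X : Y.IdealSheafData) (hX : IsLocallyPrincipal X) (hM : IsClosed (maxLocus ι X)) :
    ∃ R : ReesAlgebraData Y, IsCanonicalCentre ι J X R := by
  classical
  haveI : IsLocallyNoetherian Y := LocallyOfFiniteType.isLocallyNoetherian f
  refine exists_isCanonicalCentre_of_presentations ι J f hJ hJu X hM fun y hyM => ?_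
  have hys : y ∈ singImage X := hyM.1
  -- an affine chart with a local equation
  obtain ⟨U₀, hyU₀, F, hF⟩ := hX y
  -- the model `(A, 𝔪, F) = (Γ(Y, U₀), 𝔮_y, F)`, of finite type over `k`
  have hft : RingHom.FiniteType (f.appLE ⊤ U₀ le_top).hom :=
    HasRingHomProperty.appLE @LocallyOfFiniteType f inferInstance ⟨⊤, isAffineOpen_top _⟩ U₀ le_top
  let φ : k →+* Γ(Y, U₀) := (f.appLE ⊤ U₀ le_top).hom.comp (Scheme.ΓSpecIso (.of k)).inv.hom
  have hφ : φ.FiniteType :=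
    hft.comp (RingHom.FiniteType.of_surjective _
      (Scheme.ΓSpecIso (.of k)).commRingCatIsoToRingEquiv.symm.surjective)
  letI : Algebra k Γ(Y, U₀) := φ.toAlgebra
  haveI : Algebra.FiniteType k Γ(Y, U₀) := hφ
  set 𝔪 := (U₀.2.primeIdealOf ⟨y, hyU₀⟩).asIdeal with h𝔪
  haveI h𝔪p : 𝔪.IsPrime := (U₀.2.primeIdealOf ⟨y, hyU₀⟩).isPrime
  haveI : IsRegularLocalRing (Y.presheaf.stalk y) := isRegularLocalRing_stalk_of_smooth_of_field f y
  haveI hreg𝔪 : IsRegularLocalRing (Localization.AtPrime 𝔪) :=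
    IsRegularLocalRing.of_ringEquiv (stalkEquiv U₀ hyU₀).symm
  -- the local equation at `y`: non-zero and in `𝔪²`
  have hF0 : algebraMap Γ(Y, U₀) (Localization.AtPrime 𝔪) F ≠ 0 := fun h =>
    germ_ne_zero_of_mem_singImage X U₀ hyU₀ hF hys ((algebraMap_eq_zero_iff_germ_eq_zero U₀ hyU₀ F).mp h)
  have hF2 : algebraMap Γ(Y, U₀) (Localization.AtPrime 𝔪) F ∈ maximalIdeal (Localization.AtPrime 𝔪) ^ 2 :=
    (mem_singImage_iff_algebraMap_mem_sq X U₀ hyU₀ hF hF0).mp hys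
  -- the clause at the model (the independence at `𝔪` is not needed for [S3])
  obtain ⟨h, hh𝔪, N, U, W, hW, -, hcl⟩ := hopen k Γ(Y, U₀) 𝔪 F hreg𝔪 hF0 hF2
  -- cut away the components missing `y`: `F/1 ≠ 0` on `D(h')`
  haveI : IsNoetherianRing Γ(Y, U₀) := IsLocallyNoetherian.component_noetherian U₀
  haveI : IsDomain (Localization.AtPrime 𝔪) := isDomain_of_isRegularLocalRing _
  obtain ⟨h', hh'𝔪, hF0'⟩ := exists_not_mem_forall_algebraMap_ne_zero 𝔪 hF0
  have hhh' : h * h' ∉ 𝔪 := fun hmem => (h𝔪p.mem_or_mem hmem).elim hh𝔪 hh'𝔪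
  have hyD : y ∈ Y.basicOpen (h * h') := (mem_basicOpen_iff_not_mem U₀ hyU₀ (h * h')).mpr hhh'
  -- `ι_max = ι(A_𝔪, F/1)`
  have hmax : iotaMax ι X = ι (Localization.AtPrime 𝔪) (algebraMap Γ(Y, U₀) (Localization.AtPrime 𝔪) F) := by
    rw [← hyM.2]
    exact iotaAt_eq_iota_localization ι (hy := hyU₀) f hc6 hu X hF
  -- on `D(h h')` the model stratum is the maximum locus
  have hconv : ∀ (y' : Y) (hy' : y' ∈ (U₀ : Y.Opens)), y' ∈ Y.basicOpen (h * h') →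
      ((algebraMap Γ(Y, U₀) (Localization.AtPrime (U₀.2.primeIdealOf ⟨y', hy'⟩).asIdeal) F ∈
          maximalIdeal (Localization.AtPrime (U₀.2.primeIdealOf ⟨y', hy'⟩).asIdeal) ^ 2 ∧
        ι (Localization.AtPrime (U₀.2.primeIdealOf ⟨y', hy'⟩).asIdeal)
          (algebraMap Γ(Y, U₀) (Localization.AtPrime (U₀.2.primeIdealOf ⟨y', hy'⟩).asIdeal) F) =
          ι (Localization.AtPrime 𝔪) (algebraMap Γ(Y, U₀) (Localization.AtPrime 𝔪) F)) ↔
        y' ∈ maxLocus ι X) := by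
    intro y' hy' hy'D
    have hhh'y' : h * h' ∉ (U₀.2.primeIdealOf ⟨y', hy'⟩).asIdeal := (mem_basicOpen_iff_not_mem U₀ hy' (h * h')).mp hy'D
    have hh'y' : h' ∉ (U₀.2.primeIdealOf ⟨y', hy'⟩).asIdeal := fun hm => hhh'y' (Ideal.mul_mem_left _ h hm)
    haveI : IsRegularLocalRing (Y.presheaf.stalk y') := isRegularLocalRing_stalk_of_smooth_of_field f y'
    have h0' := hF0' (U₀.2.primeIdealOf ⟨y', hy'⟩).asIdeal hh'y'
    rw [← mem_singImage_iff_algebraMap_mem_sq X U₀ hy' hF h0', ← iotaAt_eq_iota_localization ι (hy := hy') f hc6 hu X hF,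
      ← hmax]
    rfl
  -- the presentation data at `y`, in the shape the gluing half consumes
  refine ⟨U₀, hyU₀, F, hF, h * h', hyD, N, U, W, hW, ?_, ?_⟩
  · -- stratum exactness on `D(h h')`
    intro y' hy' hy'D
    have hhh'y' : h * h' ∉ (U₀.2.primeIdealOf ⟨y', hy'⟩).asIdeal := (mem_basicOpen_iff_not_mem U₀ hy' (h * h')).mp hy'D
    have hhy' : h ∉ (U₀.2.primeIdealOf ⟨y', hy'⟩).asIdeal := fun hm => hhh'y' (Ideal.mul_mem_right h' _ hm)
    rw [← hconv y' hy' hy'D, ← (hcl (U₀.2.primeIdealOf ⟨y', hy'⟩).asIdeal hhy').1]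
    exact forall_congr' fun i => germ_mem_maximalIdeal_iff_mem U₀ hy' (U i)
  · -- presentation on the maximum locus
    intro y' hy' hy'D hy'M m
    have hhh'y' : h * h' ∉ (U₀.2.primeIdealOf ⟨y', hy'⟩).asIdeal := (mem_basicOpen_iff_not_mem U₀ hy' (h * h')).mp hy'D
    have hhy' : h ∉ (U₀.2.primeIdealOf ⟨y', hy'⟩).asIdeal := fun hm => hhh'y' (Ideal.mul_mem_right h' _ hm)
    exact (hcl (U₀.2.primeIdealOf ⟨y', hy'⟩).asIdeal hhy').2
      (((hcl (U₀.2.primeIdealOf ⟨y', hy'⟩).asIdeal hhy').1).mpr ((hconv y' hy' hy'D).mpr hy'M)) m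

end Summit.ResolutionOfSingularities.ResolutionOfSingularities.Cruxes.HypersurfaceCentreConstruction.LocalEngine

/-! ## [S3] BY NAME -/

namespace Summit.ResolutionOfSingularities.ResolutionOfSingularities.Theorems

open Summit.ResolutionOfSingularities.ResolutionOfSingularities.Cruxes.HypersurfaceCentreConstruction.LocalEngine

section Stubs

variable {p : ℕ} (ι : (R : Type) → [CommRing R] → R → Ordinal.{0})
  (J : (R : Type) → [CommRing R] → R → ℕ → Ideal R)

/-- **[S3] of door skeleton v3.1, BY NAME** (header VERBATIM as registered, skeleton 6182e6a42f97ef87; `p`, `ι`, `J` are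
section variables as in the skeleton): for `ι`, `J` satisfying (c6), (c8), (c12a), iso-invariance of `J`, the canonical
game clause and the ∀-model stratum-exact open presentation (open″), and a singular integral locally principal hypersurface
pair `(f : Y → Spec k, X)` smooth, separated and quasi-compact over a perfect field of characteristic `p`, a canonical
centre EXISTS (`IsCanonicalCentre ι J X R`: support = the maximum locus of `ι`, stalks the canonical filtration `J` there,
unit elsewhere). Closed by `exists_isCanonicalCentre_of_forallPresentation` + [S1] `stub_maxLocus`; `hgame` and
`IsSeparated` are idle. [cite: Wlodarczyk2022, §2.2 and 2.1.10] -/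
theorem stub_exists_isCanonicalCentre (hc6 : IotaIsoInvariant ι) (hc8 : IotaUpperSemicontinuous ι)
    (hu : IotaUnitInvariant ι) (hJ : JIsoInvariant J) (hJu : JUnitInvariant J) (hgame : CanonicalGameClause p ι J)
    (hopen : JOpenPresentationForallSing p ι J)
    {k : Type} [Field k] [CharP k p] [PerfectField k] {Y : Scheme.{0}} (f : Y ⟶ Spec (.of k)) [Smooth f]
    [IsSeparated f] [QuasiCompact f] (X : Y.IdealSheafData) (hX : IsLocallyPrincipal X)
    (hXi : IsIntegral X.subscheme) (hsing : ¬ Scheme.IsRegular X.subscheme) :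
    ∃ R : ReesAlgebraData Y, IsCanonicalCentre ι J X R :=
  have _unused : CanonicalGameClause p ι J := hgame
  exists_isCanonicalCentre_of_forallPresentation ι J hc6 hu hJ hJu hopen f X hX
    (stub_maxLocus ι hc6 hc8 hu f X hX hXi hsing).1

end Stubs

end Summit.ResolutionOfSingularities.ResolutionOfSingularities.Theorems

end
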